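import Summits.AnomalousDissipation.AnomalousDissipation.Theorems.SawtoothPulseCascadeK3LocalisedClosureApproxBookkeeping
import Summits.AnomalousDissipation.AnomalousDissipation.Theorems.SawtoothPulseCascadeK3LocalisedClosureApproxResponse
import Summits.AnomalousDissipation.AnomalousDissipation.Theorems.SawtoothPulseCascadeLipAgmonEnvelopeOfL2P
import Summits.AnomalousDissipation.AnomalousDissipation.Theorems.SawtoothPulseCascadeLipAgmonCaps

/-!
# `ApproximateSolution ⟨γ, δ₀, 2, 1, 2⟩ (γ²−3)` from a K2-cap with SYMBOLIC constant `C` (the C-knob of the crux K2′)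
(route `AnomalousDissipation/SawtoothPulseCascade`; helper for the crux K1loc = stmt-AnomalousDissipation-19491 —
sequel of `…LipAgmonApproxSolP` (p664303); no route-file import)

The composition of p664303 consumes `K2PhaseGrowthClassical P 3`; the constant `3` is used exactly once, in the drift-free
window `max (3e^{σ⋆γ}) (2ρN) < γ² − 3` of the `L²` envelope.  Here the cap is a parameter:
`LipAgmon.approximateSolution_PC : γ ∈ [5,8] → 0 < δ₀ → 0 ≤ C → C·e^{σ⋆γ} < γ²−3 →
K2PhaseGrowthClassical ⟨γ,δ₀,2,1,2⟩ C → ApproximateSolution ⟨γ,δ₀,2,1,2⟩ (γ²−3)`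
(`ApproxResponse.responseL2EnvelopePC` + `lipEnvelope_of_caps_of_L2_P` + `caps_H/caps_V` + `envelopeBookkeeping`), and the
numeric window at the K1 witness `γ = 8`: `e^{8σ⋆} ≤ 11.925`, so every `C ≤ 5` is admissible (`5·11.925 = 59.625 < 61`).
-/

set_option linter.dupNamespace false

noncomputable section

open Set MeasureTheory
open Literature.Analysis Literature.Analysis.FunctionSpaces Literature.Analysis.FluidPDE
open Literature.Analysis.FluidPDE.SawtoothCascade
open Literature.Analysis.FluidPDE.SawtoothCascade.DriftFree

namespace Summit.AnomalousDissipation.AnomalousDissipation.Theorems.SawtoothPulseCascade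

namespace LipAgmon

/-- **`ApproximateSolution ⟨γ, δ₀, 2, 1, 2⟩ (γ²−3)` from a K2-cap with SYMBOLIC constant `C`** (`γ ∈ [5,8]`, `0 < δ₀`,
`0 ≤ C`, `C·e^{σ⋆γ} < γ² − 3`): S1 = `ApproxResponse.responseL2EnvelopePC`, S2 = `lipEnvelope_of_caps_of_L2_P` with the
profile caps `caps_H`/`caps_V`, S3 = `DriftFreeApprox.envelopeBookkeeping` (carrier rates are `γ`-only), assembled by
`DriftFreeApprox.approximateSolution_of_envelopes` on the response of `DriftFreeApprox.exists_linearisedResponse` — the proof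
of `approximateSolution_of_lipEnvelope_P` with the `L²` envelope taken at cap `C`. [folklore] -/
theorem approximateSolution_PC {γ : ℝ} (hγ : γ ∈ Icc (5 : ℝ) 8) {δ₀ : ℝ} (hδ₀ : 0 < δ₀) {C : ℝ} (hC0 : 0 ≤ C)
    (hCr : C * Real.exp (sawSigmaStar * γ) < γ ^ 2 - 3)
    (hK2 : K2PhaseGrowthClassical ⟨γ, δ₀, 2, 1, 2⟩ C) :
    ApproximateSolution ⟨γ, δ₀, 2, 1, 2⟩ (γ ^ 2 - 3) := by
  have hγ0 : (0 : ℝ) ≤ γ := le_trans (by norm_num) hγ.1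
  have hρN : (2 : ℕ) ∈ Finset.Icc 2 7 := Finset.mem_Icc.2 ⟨le_rfl, by norm_num⟩
  have hL2 := ApproxResponse.responseL2EnvelopePC hγ hδ₀ hρN hC0 hCr hK2
  obtain ⟨M₁, K₁, hM₁0, hM₁, hK₁0, H2⟩ := lipEnvelope_of_caps_of_L2_P hγ hδ₀ (c₃ := 8 * Real.pi ^ 2)
    (c₄ := 80 * Real.pi ^ 3 / Real.sqrt (2 * Real.pi)) (c₅ := 192 * Real.pi ^ 4) (by positivity) (by positivity)
    (by positivity) (fun ν j => caps_H ⟨γ, δ₀, 2, 1, 2⟩ hγ0 hδ₀ (by norm_num) ν j)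
    (fun ν j => caps_V ⟨γ, δ₀, 2, 1, 2⟩ hγ0 hδ₀ (by norm_num) ν j) hL2
  obtain ⟨M₂, K₂, hM₂0, hM₂, hK₂0, H1⟩ := hL2
  refine DriftFreeApprox.approximateSolution_of_envelopes ⟨γ, δ₀, 2, 1, 2⟩ hγ0 hδ₀ (by norm_num) ?_
  intro A ε hε
  obtain ⟨ν₁, hν₁, H1A⟩ := H1 A
  obtain ⟨ν₂, hν₂, H2A⟩ := H2 A
  obtain ⟨ν₃, hν₃, H3A⟩ :=
    DriftFreeApprox.envelopeBookkeeping γ hγ 2 hρN M₁ M₂ K₁ K₂ hM₁0 hM₁ hM₂0 hM₂ hK₁0 hK₂0 A ε hε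
  refine ⟨min ν₁ (min ν₂ ν₃), lt_min hν₁ (lt_min hν₂ hν₃), fun ν hν => ?_⟩
  have hn1 : ν ∈ Set.Ioc 0 ν₁ := ⟨hν.1, hν.2.trans (min_le_left _ _)⟩
  have hn2 : ν ∈ Set.Ioc 0 ν₂ := ⟨hν.1, (hν.2.trans (min_le_right _ _)).trans (min_le_left _ _)⟩
  have hn3 : ν ∈ Set.Ioc 0 ν₃ := ⟨hν.1, (hν.2.trans (min_le_right _ _)).trans (min_le_right _ _)⟩
  set T := horizon (γ ^ 2 - 3) ν A with hT
  have hT0 : 0 ≤ T := CascadeParams.tStart_nonneg _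
  have hT1 : T < 1 := CascadeParams.tStart_lt_one _
  set T' : ℝ := (T + 1) / 2 with hT'
  have hTT' : T < T' := by rw [hT']; linarith
  have hT'1 : T' < 1 := by rw [hT']; linarith
  have hT'0 : 0 < T' := hT0.trans_lt hTT'
  obtain ⟨L, q, hL, hq, hdiv, hL0, hlin⟩ :=
    DriftFreeApprox.exists_linearisedResponse ⟨γ, δ₀, 2, 1, 2⟩ hδ₀ (by norm_num) hν.1 hT'0 hT'1
  obtain ⟨Λ, hΛc, hΛ, hΛle⟩ := H2A ν hn2 T' hTT' hT'1 L q hL hq hdiv hL0 hlin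
  have hEle := H1A ν hn1 T' hTT' hT'1 L q hL hq hdiv hL0 hlin
  set E : ℝ → ℝ := fun t => Real.sqrt (FluidPDE.Torus.vectorL2Sq (L t)) with hE
  have hEc : ContinuousOn E (Set.Icc 0 T) := by
    have h := (hL.continuousOn_integral_norm_sq (convex_Icc 0 T')).mono (Set.Icc_subset_Icc le_rfl hTT'.le)
    exact (Real.continuous_sqrt.comp_continuousOn h).congr fun s _ => rfl
  have henv : ∀ j : ℕ, ∀ t ∈ Set.Icc 0 T, t ∈ Set.Icc (CascadeParams.tStart j) (CascadeParams.tStart (j + 1)) →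
      0 ≤ E t ∧ E t ≤ K₂ * ν * ((j : ℝ) + 1) * M₂ ^ (j + 1) ∧
      0 ≤ Λ t ∧ Λ t ≤ K₁ * ν * ((j : ℝ) + 1) * M₁ ^ (j + 1) :=
    fun j t ht hj => ⟨Real.sqrt_nonneg _, hEle j t ht hj, (norm_nonneg _).trans (hΛ t ht 0), hΛle j t ht hj⟩
  obtain ⟨hint, hdef⟩ := H3A ν hn3 E Λ hEc hΛc henv
  exact ⟨T', hTT', hT'1, L, q, E, Λ, hL, hq, hdiv, hL0, hlin, fun t _ => le_rfl, hΛ, hEc, hΛc, hint, hdef⟩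

end LipAgmon

/-- Numeric: `e^{8σ⋆} = e^{2.47856} ≤ 11.925` (`Real.exp_bound'` at `2.47856/4`, `n = 6`, fourth power; the same bound as
the tree's private `SawtoothClosureMargin.exp_sawSigmaStar_mul_eight_le`). [folklore] -/
theorem exp_sawSigmaStar_mul_eight_le_11925 : Real.exp (sawSigmaStar * 8) ≤ 11925 / 1000 := by
  have h := Real.exp_bound' (x := (15491 / 25000 : ℝ)) (by norm_num) (by norm_num) (n := 6) (by norm_num)
  simp only [Finset.sum_range_succ, Finset.sum_range_zero, Nat.factorial] at h
  norm_num at h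
  have h4 : Real.exp (sawSigmaStar * 8) = Real.exp (15491 / 25000 : ℝ) ^ 4 := by
    rw [← Real.exp_nat_mul]; norm_num [sawSigmaStar]
  rw [h4]
  have hpos : 0 ≤ Real.exp (15491 / 25000 : ℝ) := (Real.exp_pos _).le
  calc Real.exp (15491 / 25000 : ℝ) ^ 4 ≤ _ ^ 4 := pow_le_pow_left₀ hpos h 4
    _ ≤ _ := by norm_num

/-- **The cap window at `γ = 8`**: `C·e^{8σ⋆} < 8² − 3` for every `C ≤ 5`. [folklore] -/
theorem cap_window_eight {C : ℝ} (hC5 : C ≤ 5) : C * Real.exp (sawSigmaStar * 8) < (8 : ℝ) ^ 2 - 3 := by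
  have he := exp_sawSigmaStar_mul_eight_le_11925
  have he0 : 0 ≤ Real.exp (sawSigmaStar * 8) := (Real.exp_pos _).le
  nlinarith [mul_le_mul_of_nonneg_right hC5 he0]

end Summit.AnomalousDissipation.AnomalousDissipation.Theorems.SawtoothPulseCascade

end
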